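import Literature.NumberTheory.GaloisRepresentations.SGeneralQuadraticFamily
import Literature.NumberTheory.GaloisRepresentations.SorensenPatchingHypotheses
import Literature.NumberTheory.GaloisRepresentations.RestrictFieldSemisimple
import Literature.NumberTheory.GaloisRepresentations.FramedRepEquivConj
import Literature.NumberTheory.Automorphic.ReciprocityGLnGaloisConjProofs
import Literature.NumberTheory.Automorphic.ReciprocityGLnRestrictionProofs
import Literature.NumberTheory.Automorphic.ReciprocityGLnDescentProofs
import HarnessLib

/-!
# Patching Galois representations over the family `K(√-D)`: the Galois side of
# Harris–Lan–Taylor–Thorne's Cor. 7.14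

Topic `Literature/NumberTheory/Automorphic`.  The printed proof of Harris–Lan–Taylor–Thorne's
Cor. 7.14 = Thm. A (`HarrisLanTaylorThorne2016.theoremA_existence`; Res. Math. Sci. 3:37 (2016),
p. 232: "This can be deduced from Theorem 7.13 by using lemma 1 of [54]. (This is the same
argument used in the proof of theorem VII.1.9 of [29].)") has an automorphic half — Thm. 7.13
applied to the base changes `π_A` of `π` to the fields `F_A = E·A` — and a Galois half, the
argument of Harris–Taylor, proof of Thm. VII.1.9 (pp. 229–232): "It follows from the Čebotarev
density theorem that the resulting Galois representation … satisfies `R^{σ_A} ≅ R` and that the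
two restrictions to `Gal(L^{ac}/F_AF_{A'})` agree … Hence [patching] … Given any finite place `y`
of `L` we can choose an imaginary quadratic extension `A/ℚ` such that … `y` splits as `y'y''` in
`LA` … and so `[R_l(Π)|_{W_{F_y}}] = [r_l(ı⁻¹Π_y)]`".  This file proves the **Galois half** in
full, over the `∅`-general family `K(√-D)` of `SGeneralQuadraticFamily` (index type
`QuadraticFamily.GoodPrime K m X`, patching lemma `GoodPrime.exists_framedGaloisRep` = Sorensen's
Lemma 2), for an abstract **Frobenius datum** on `K`:

* `frobPoly E v f = ∏_{a ∈ E v} (X - a^f)` — the characteristic polynomial predicted at a place of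
  residue degree `f` over `v` by a datum `E : places(K) → Multiset k` of Frobenius eigenvalues
  (for Cor. 7.14: the roots of `arithFrobPolyOfSatake ı q_v n α_v`; `α ↦ α^{f(w|v)}` is the
  unramified base-change relation, Arthur–Clozel Ch. 3 (1.1), and
  `FramedGaloisRep.hasFrobCharpolyAt_restrictField`);
* `CompatibleAE E ρ` — `ρ : Γ_M → GL_n(k)` (`M ⊇ K`) is unramified with characteristic polynomial
  `frobPoly E v f(w|v)` at all but finitely many places `w ∣ v` of `M` (what Thm. 7.13 plus a weak
  base change give for `r_{p,ı}(π_A)` on `Γ_{F_A}`);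
* `CompatibleAE.restrictField` (towers `K ⊆ M ⊆ L`: `f(u|v) = f(w|v) f(u|w)`),
  `CompatibleAE.nonempty_equiv` (two such semisimple `ρ` on the same `Γ_M` are isomorphic:
  Chebotarev + Brauer–Nesbitt, `FramedGaloisRep.nonempty_equiv_of_hasFrobCharpolyAt_eventually`),
  `CompatibleAE.nonempty_equiv_outerConj` (**Sorensen's (a)**, `ρ^τ ≅ ρ`:
  `FramedGaloisRep.nonempty_equiv_outerConj_of_under`), `CompatibleAE.exists_conj`
  (**Sorensen's (b)** in its intrinsic form, through any field `L` with towers `K ⊆ K_i ⊆ L`,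
  `K ⊆ K_j ⊆ L` generated by `K_i, K_j`: `SorensenPatching.exists_conj_of_equiv_restrictField`);
* the fields `L` for two members `K(√-D), K(√-D')`: the biquadratic `K(√-D)(√-D')`
  (`compField`, `toComp`, when `-D'` is not a square in `K(√-D)`) or `K(√-D)` itself
  (`algebraSelfOfSq`, `tower_selfOfSq`, when it is — e.g. `D = D'`), `GoodPrime.exists_conj` (hypothesis (b) for every
  pair of members);
* `GoodPrime.exists_framedGaloisRep_of_compatibleAE` — **the Galois side of Cor. 7.14**: given
  semisimple `ρ_D : Γ_{K(√-D)} → GL_n(k)`, `D ∈ GoodPrime K m X`, all `CompatibleAE` with one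
  datum `E`, and a set `T` of places of `K` each of which splits completely in some member
  `K(√-D)` with `ρ_D` unramified of characteristic polynomial `∏_{a ∈ E v}(X - a)` at the places
  above it, there is a continuous semisimple `r : Γ_K → GL_n(k)` with `r|_{Γ_{K(√-D)}} ≅ ρ_D`
  for all `D`, unramified with characteristic polynomial `∏_{a ∈ E v}(X - a)` at every `v ∈ T`
  (patch by `GoodPrime.exists_framedGaloisRep`; read off at `v ∈ T` through the split member:
  `FramedGaloisRep.isUnramifiedAt_of_restrictField`, `hasFrobCharpolyAt_of_restrictField` of
  `ReciprocityGLnDescentProofs`); `r` is unique up to isomorphism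
  (`GoodPrime.nonempty_equiv_of_forall_restrictField`).

Everything is proved (Chebotarev enters through the discharged
`Literature.NumberTheory.Automorphic.chebotarev_artinRep_holds`); no named facts.  What remains
of Cor. 7.14 is automorphic: Thm. 7.13 (`theorem713_of_leaves`, modulo its leaves) for the base
change of `π` to each member (members are CM with `p` split in `ℚ(√-D) ⊆ K(√-D)`,
`ReciprocityGLnPatchingFamily`), and the base-change relation `α_w = α_v^{f(w|v)}` at the
unramified places (Arthur–Clozel, Ch. 3, Thm. 4.2 with Ch. 1 §6), which supply `ρ_D`, `E`,
`CompatibleAE` and the hypothesis on `T` = the places over the rational primes `q ≠ p` above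
which `π` is unramified (members with `8q ∣ D + 1`, `GoodPrime.exists_dvd_split`).

## References

* M. Harris, K.-W. Lan, R. Taylor, J. Thorne, *On the rigid cohomology of certain Shimura
  varieties*, Res. Math. Sci. 3:37 (2016), Thm. 7.13 and proof of Cor. 7.14 (p. 232).
  [HarrisLanTaylorThorneRMS2016]
* M. Harris, R. Taylor, *The geometry and cohomology of some simple Shimura varieties*, Ann. of
  Math. Stud. 151 (2001), proof of Thm. VII.1.9 (pp. 229–232). [HarrisTaylorAMS2001]
* C. M. Sorensen, *A patching lemma*, in: Shimura Varieties, LMS Lecture Note Ser. 457 (2020),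
  § 1, Lemma 2 and conditions (a), (b). [Sorensen2020]
* J. Arthur, L. Clozel, *Simple algebras, base change, and the advanced theory of the trace
  formula*, Ann. of Math. Stud. 120 (1989), Ch. 3, (1.1). [ArthurClozelAMS120]
-/

noncomputable section

open scoped NumberField Polynomial MatrixGroups
open Field IsDedekindDomain NumberField Polynomial Filter
open Literature.NumberTheory.GaloisRepresentations
open Literature.NumberTheory.GaloisRepresentations.QuadraticFamily

namespace Literature.NumberTheory.Automorphic

namespace PatchingFamily

/-! ### Frobenius data and almost-everywhere compatibility -/

section Datum

variable {K : Type*} [Field K] {k : Type*} [CommRing k]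

/-- **The characteristic polynomial predicted at a place of residue degree `f` over `v`** by a
datum `E` of Frobenius eigenvalues on `K`: `∏_{a ∈ E v} (X - a^f)` (the eigenvalues of
`Frob_w = Frob_v^{f(w|v)}`; on the automorphic side the unramified base-change relation
`t_{Π,w} = t_{π,v}^{f(w|v)}`, Arthur–Clozel Ch. 3 (1.1)). [cite: ArthurClozelAMS120, Ch. 3 (1.1)] -/
def frobPoly (E : HeightOneSpectrum (𝓞 K) → Multiset k) (v : HeightOneSpectrum (𝓞 K)) (f : ℕ) :
    Polynomial k :=
  ((E v).map fun a ↦ X - C (a ^ f)).prod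

/-- At residue degree `1`: `frobPoly E v 1 = ∏_{a ∈ E v} (X - a)`. [folklore] -/
theorem frobPoly_one (E : HeightOneSpectrum (𝓞 K) → Multiset k) (v : HeightOneSpectrum (𝓞 K)) :
    frobPoly E v 1 = ((E v).map fun a ↦ X - C a).prod := by
  simp [frobPoly]

/-- `frobPoly E v (f g) = ∏_{b ∈ (E v)^f} (X - b^g)`. [folklore] -/
theorem frobPoly_mul (E : HeightOneSpectrum (𝓞 K) → Multiset k) (v : HeightOneSpectrum (𝓞 K))
    (f g : ℕ) :
    frobPoly E v (f * g) = (((E v).map (· ^ f)).map fun b ↦ X - C (b ^ g)).prod := by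
  simp [frobPoly, Multiset.map_map, pow_mul]

/-- `frobPoly E v f` in the root form `∏_{b ∈ (E v)^f} (X - b)`. [folklore] -/
theorem frobPoly_eq_prod_map_pow (E : HeightOneSpectrum (𝓞 K) → Multiset k)
    (v : HeightOneSpectrum (𝓞 K)) (f : ℕ) :
    frobPoly E v f = (((E v).map (· ^ f)).map fun b ↦ X - C b).prod := by
  simp [frobPoly, Multiset.map_map]

variable [NumberField K] {M : Type*} [Field M] [NumberField M] [Algebra K M] [TopologicalSpace k]
  {n : ℕ}

/-- **Almost-everywhere compatibility with a Frobenius datum on `K`.**  A framed Galois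
representation `ρ : Γ_M → GL_n(k)` of an extension `M ⊇ K` is *compatible almost everywhere*
with the datum `E` on `K` if at all but finitely many finite places `w` of `M` it is unramified
with characteristic polynomial of (arithmetic) Frobenius `frobPoly E v f(w|v)`, `v = w ∩ K`.
For Cor. 7.14: the shape of the Frobenius data of `r_{p,ı}(π_A)` on `Γ_{F_A}` given by Thm. 7.13
and the base-change relation (almost everywhere).
[cite: HarrisLanTaylorThorneRMS2016, Thm. 7.13 and proof of Cor. 7.14 (p. 232)] -/
def CompatibleAE (E : HeightOneSpectrum (𝓞 K) → Multiset k) (ρ : FramedGaloisRep M k n) : Prop :=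
  ∀ᶠ w : HeightOneSpectrum (𝓞 M) in cofinite,
    ρ.IsUnramifiedAt w ∧
      ρ.HasFrobCharpolyAt w (frobPoly E (w.under (𝓞 K)) (w.asIdeal.inertiaDeg (𝓞 K)))

end Datum

/-! ### Towers: restriction preserves compatibility -/

section Tower

variable {K M L : Type*} [Field K] [NumberField K] [Field M] [NumberField M] [Field L]
  [NumberField L] [Algebra K M] [Algebra M L] [Algebra K L] [IsScalarTower K M L]
  {k : Type*} [Field k] [TopologicalSpace k] {n : ℕ}

omit [NumberField K] [NumberField M] [NumberField L] in
/-- In a tower `K ⊆ M ⊆ L` of number fields, `(u ∩ M) ∩ K = u ∩ K` for a place `u` of `L`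
(Mathlib `Ideal.under_under`). [folklore] -/
theorem under_under_eq (u : HeightOneSpectrum (𝓞 L)) :
    (u.under (𝓞 M)).under (𝓞 K) = u.under (𝓞 K) :=
  HeightOneSpectrum.ext (Ideal.under_under (A := 𝓞 K) (B := 𝓞 M) u.asIdeal)

omit [NumberField K] [NumberField M] [NumberField L] in
/-- In a tower `K ⊆ M ⊆ L`: `f(u|v) = f(w|v) f(u|w)` for `u` a place of `L` over `w` of `M` over
`v` of `K` (Mathlib `Ideal.inertiaDeg_tower`). [folklore] -/
theorem inertiaDeg_eq_mul (u : HeightOneSpectrum (𝓞 L)) :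
    u.asIdeal.inertiaDeg (𝓞 K) =
      (u.under (𝓞 M)).asIdeal.inertiaDeg (𝓞 K) * u.asIdeal.inertiaDeg (𝓞 M) := by
  rw [HeightOneSpectrum.under_asIdeal]
  exact Ideal.inertiaDeg_tower (R := 𝓞 K) (u.asIdeal.under (𝓞 M)) u.asIdeal

omit [NumberField K] in
/-- **Restriction preserves almost-everywhere compatibility.**  If `ρ : Γ_M → GL_n(k)` is
compatible almost everywhere with the datum `E` on `K ⊆ M`, so is `ρ|_{Γ_L}` for any further
number field `L ⊇ M`: at a place `u ∣ w ∣ v`, `ρ|_{Γ_L}` is unramified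
(`FramedGaloisRep.isUnramifiedAt_restrictField`) with Frobenius characteristic polynomial
`∏ (X - (a^{f(w|v)})^{f(u|w)}) = frobPoly E v f(u|v)` (`FramedGaloisRep.hasFrobCharpolyAt_restrictField`,
`f(u|v) = f(w|v) f(u|w)`), and only finitely many `u` lie over the finitely many bad `w`
(`finite_setOf_under_eq`). [folklore] -/
theorem CompatibleAE.restrictField {E : HeightOneSpectrum (𝓞 K) → Multiset k}
    {ρ : FramedGaloisRep M k n} (h : CompatibleAE E ρ) :
    CompatibleAE E (ρ.restrictField L) := by
  rw [CompatibleAE, Filter.eventually_cofinite] at h ⊢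
  refine (h.preimage' (f := fun u : HeightOneSpectrum (𝓞 L) ↦ u.under (𝓞 M))
    fun w _ ↦ finite_setOf_under_eq (M := L) w).subset fun u hu ↦ ?_
  simp only [Set.mem_preimage, Set.mem_setOf_eq] at hu ⊢
  contrapose! hu
  obtain ⟨hunr, hch⟩ := hu
  set w : HeightOneSpectrum (𝓞 M) := u.under (𝓞 M) with hwdef
  have hw : u.asIdeal.under (𝓞 M) = w.asIdeal := by rw [hwdef, HeightOneSpectrum.under_asIdeal]
  refine ⟨ρ.isUnramifiedAt_restrictField hw hunr, ?_⟩
  set v : HeightOneSpectrum (𝓞 K) := w.under (𝓞 K) with hvdef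
  set s : Multiset k := (E v).map (· ^ w.asIdeal.inertiaDeg (𝓞 K)) with hs
  have hch' : ρ.HasFrobCharpolyAt w ((s.map fun a ↦ X - C a).prod) := by
    rw [hs, ← frobPoly_eq_prod_map_pow]
    exact hch
  have key := ρ.hasFrobCharpolyAt_restrictField (E := L) hw hunr hch'
  have hvu : u.under (𝓞 K) = v := by rw [hvdef, hwdef, under_under_eq]
  rw [hvu, inertiaDeg_eq_mul (M := M) u, frobPoly_mul, ← hwdef, ← hs]
  exact key

end Tower

/-! ### Chebotarev: uniqueness and Galois invariance -/

section Chebotarev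

variable {K M : Type} [Field K] [NumberField K] [Field M] [NumberField M] [Algebra K M]
  {k : Type*} [Field k] [TopologicalSpace k] [IsTopologicalRing k] [T2Space k] [CharZero k]
  {n : ℕ}

omit [NumberField K] in
/-- **Two semisimple representations of `Γ_M` compatible almost everywhere with the same datum
are isomorphic** (Chebotarev + Brauer–Nesbitt:
`FramedGaloisRep.nonempty_equiv_of_hasFrobCharpolyAt_eventually`, Chebotarev discharged as
`chebotarev_artinRep_holds`) — Harris–Taylor's "the two restrictions to `Gal(L^{ac}/F_AF_{A'})`
agree" and the uniqueness in Sorensen's Lemma 2.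
[cite: HarrisTaylorAMS2001, proof of Thm. VII.1.9 (p. 230)] -/
theorem CompatibleAE.nonempty_equiv {E : HeightOneSpectrum (𝓞 K) → Multiset k}
    {r r' : FramedGaloisRep M k n} (hr : r.toGaloisRep.IsSemisimple)
    (hr' : r'.toGaloisRep.IsSemisimple) (h : CompatibleAE E r) (h' : CompatibleAE E r') :
    Nonempty (ContinuousRep.Equiv r.toGaloisRep r'.toGaloisRep) := by
  refine FramedGaloisRep.nonempty_equiv_of_hasFrobCharpolyAt_eventually chebotarev_artinRep_holds
    r r' hr hr' ?_
  filter_upwards [h, h'] with w h1 h2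
  exact ⟨h1.1, h2.1, _, h1.2, h2.2⟩

/-- **Sorensen's hypothesis (a): `ρ^τ ≅ ρ` for a representation compatible almost everywhere with
a datum coming from `K`** (`M/K` Galois, `τ ∈ Γ_K`): the datum is `Gal(M/K)`-stable
(`τ̄ w ∩ K = w ∩ K`, `f(τ̄ w|v) = f(w|v)`), so `FramedGaloisRep.nonempty_equiv_outerConj_of_under`
applies — Harris–Taylor's "it follows from the Čebotarev density theorem that … `R^{σ_A} ≅ R`".
[cite: HarrisTaylorAMS2001, proof of Thm. VII.1.9 (p. 230)] [cite: Sorensen2020, §1 (a)] -/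
theorem CompatibleAE.nonempty_equiv_outerConj [IsGalois K M]
    {E : HeightOneSpectrum (𝓞 K) → Multiset k} {ρ : FramedGaloisRep M k n}
    (hρ : ρ.toGaloisRep.IsSemisimple) (h : CompatibleAE E ρ) (τ : absoluteGaloisGroup K) :
    Nonempty (ContinuousRep.Equiv (ρ.outerConj τ).toGaloisRep ρ.toGaloisRep) :=
  FramedGaloisRep.nonempty_equiv_outerConj_of_under ρ hρ τ (h.mono fun _ hw ↦ hw.1)
    (fun v f ↦ frobPoly E v f) (h.mono fun _ hw ↦ hw.2)

variable {Kᵢ Kⱼ L : Type} [Field Kᵢ] [NumberField Kᵢ] [Field Kⱼ] [NumberField Kⱼ] [Field L]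
  [NumberField L] [Algebra K Kᵢ] [Algebra K Kⱼ] [Algebra K L] [Algebra Kᵢ L] [Algebra Kⱼ L]
  [IsScalarTower K Kᵢ L] [IsScalarTower K Kⱼ L] [IsGalois K Kᵢ] [IsGalois K Kⱼ]
  [IsGalois Kᵢ L] [IsGalois Kⱼ L]

/-- **Sorensen's hypothesis (b), intrinsic form, for representations compatible almost
everywhere with one datum.**  Let `K_i, K_j ⊇ K` be Galois, `L` a number field with towers
`K ⊆ K_i ⊆ L`, `K ⊆ K_j ⊆ L`, Galois over both and generated by them (`hcomp`), and
`ρ_i : Γ_{K_i} → GL_n(k)`, `ρ_j : Γ_{K_j} → GL_n(k)` semisimple and compatible almost everywhere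
with the same datum `E` on `K`.  Then one matrix conjugates `ρ_i(x)` to `ρ_j(y)` whenever `x, y`
have the same image in `Γ_K`: both restrictions to `Γ_L` are compatible with `E`
(`CompatibleAE.restrictField`), hence isomorphic (`CompatibleAE.nonempty_equiv`), and
`SorensenPatching.exists_conj_of_equiv_restrictField` (with (a),
`CompatibleAE.nonempty_equiv_outerConj`) converts this printed form of (b) into the intrinsic
one. [cite: Sorensen2020, §1 (b)] [cite: HarrisTaylorAMS2001, proof of Thm. VII.1.9 (p. 230)] -/
theorem CompatibleAE.exists_conj
    (hcomp : (IsScalarTower.toAlgHom K Kᵢ L).fieldRange ⊔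
      (IsScalarTower.toAlgHom K Kⱼ L).fieldRange = ⊤)
    {E : HeightOneSpectrum (𝓞 K) → Multiset k} {ρᵢ : FramedGaloisRep Kᵢ k n}
    {ρⱼ : FramedGaloisRep Kⱼ k n} (hssᵢ : ρᵢ.toGaloisRep.IsSemisimple)
    (hssⱼ : ρⱼ.toGaloisRep.IsSemisimple) (hᵢ : CompatibleAE E ρᵢ) (hⱼ : CompatibleAE E ρⱼ) :
    ∃ P : GL (Fin n) k, ∀ (x : absoluteGaloisGroup Kᵢ) (y : absoluteGaloisGroup Kⱼ),
      absGaloisRestrict K Kᵢ x = absGaloisRestrict K Kⱼ y → ρⱼ y = P * ρᵢ x * P⁻¹ := by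
  haveI : Algebra.IsAlgebraic K L := Algebra.IsAlgebraic.trans K Kᵢ L
  exact SorensenPatching.exists_conj_of_equiv_restrictField hcomp ρᵢ ρⱼ
    (hᵢ.nonempty_equiv_outerConj hssᵢ) (hⱼ.nonempty_equiv_outerConj hssⱼ)
    ((hᵢ.restrictField (L := L)).nonempty_equiv (ρᵢ.isSemisimple_restrictField (M := L) hssᵢ)
      (ρⱼ.isSemisimple_restrictField (M := L) hssⱼ) (hⱼ.restrictField (L := L)))

end Chebotarev

/-! ### The fields `L ⊇ K(√-D), K(√-D')` -/

section Fields

variable {K : Type} [Field K] {D D' : ℕ} [Fact (¬ IsSquare (-(D : K)))]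
  [Fact (¬ IsSquare (-(D' : K)))]

/-- **The `K`-embedding `K(√-D') → A` attached to a square root `x` of `-D'` in a `K`-algebra
`A`** (`ω ↦ x`; Mathlib `QuadraticAlgebra.lift`). [folklore] -/
def liftOfSq {A : Type*} [CommRing A] [Algebra K A] (x : A)
    (hx : x ^ 2 = algebraMap K A (-(D' : K))) : sqrtNegField K D' →ₐ[K] A :=
  QuadraticAlgebra.lift ⟨x, by
    rw [zero_smul, add_zero, Algebra.smul_def, mul_one, ← hx, sq]⟩

/-- `liftOfSq x hx ω = x`. [folklore] -/
@[simp] theorem liftOfSq_omega {A : Type*} [CommRing A] [Algebra K A] (x : A)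
    (hx : x ^ 2 = algebraMap K A (-(D' : K))) :
    liftOfSq x hx (QuadraticAlgebra.omega : sqrtNegField K D') = x := by
  simp [liftOfSq, QuadraticAlgebra.lift, QuadraticAlgebra.omega]

/-! #### Generic case: the biquadratic field `K(√-D)(√-D')` -/

/-- **The biquadratic field `K(√-D, √-D') = K(√-D)(√-D')`** (a field when `-D'` is not a square in
`K(√-D)`); a number field, quadratic (Galois) over `K(√-D)`, with `K`- and `K(√-D)`-algebra
structures in a tower (Mathlib instances on `QuadraticAlgebra`). [folklore] -/
abbrev compField (K : Type) [Field K] (D D' : ℕ) [Fact (¬ IsSquare (-(D : K)))] : Type :=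
  sqrtNegField (sqrtNegField K D) D'

section Generic

variable [Fact (¬ IsSquare (-(D' : sqrtNegField K D)))]

omit [Fact (¬ IsSquare (-(D' : K)))] in
/-- `ω² = -D'` in `K(√-D)(√-D')`, over `K`. [folklore] -/
theorem omega_comp_sq :
    (QuadraticAlgebra.omega : compField K D D') ^ 2 =
      algebraMap K (compField K D D') (-(D' : K)) := by
  rw [omega_sq, map_neg, map_natCast, map_neg, map_natCast]

variable (K D D') in
/-- The `K`-embedding `K(√-D') → K(√-D)(√-D')`, `ω' ↦ ω`. [folklore] -/
def toComp : sqrtNegField K D' →ₐ[K] compField K D D' :=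
  liftOfSq QuadraticAlgebra.omega omega_comp_sq

variable (K D D') in
/-- The `K(√-D')`-algebra structure on `K(√-D)(√-D')` through `toComp` (used as a local
instance). [folklore] -/
abbrev algebraComp : Algebra (sqrtNegField K D') (compField K D D') :=
  (toComp K D D').toRingHom.toAlgebra

attribute [local instance] algebraComp

/-- `K ⊆ K(√-D') ⊆ K(√-D)(√-D')` is a tower. [folklore] -/
theorem isScalarTower_comp : IsScalarTower K (sqrtNegField K D') (compField K D D') :=
  IsScalarTower.of_algebraMap_eq fun x ↦ ((toComp K D D').commutes x).symm

attribute [local instance] isScalarTower_comp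

/-- **`K(√-D)(√-D')` is generated by `K(√-D)` and `K(√-D')`**: `a + bω = a + b·toComp(ω')`.
[folklore] -/
theorem fieldRange_sup_fieldRange_comp :
    (IsScalarTower.toAlgHom K (sqrtNegField K D) (compField K D D')).fieldRange ⊔
      (IsScalarTower.toAlgHom K (sqrtNegField K D') (compField K D D')).fieldRange = ⊤ := by
  rw [eq_top_iff]
  intro x _
  have hx : x = algebraMap (sqrtNegField K D) (compField K D D') x.re +
      algebraMap (sqrtNegField K D) (compField K D D') x.im *
        (toComp K D D' (QuadraticAlgebra.omega : sqrtNegField K D')) := by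
    rw [toComp, liftOfSq_omega]
    conv_lhs => rw [← QuadraticAlgebra.mk_eta x, QuadraticAlgebra.mk_eq_add_smul_omega,
      Algebra.smul_def]
  rw [hx]
  have h₁ : (IsScalarTower.toAlgHom K (sqrtNegField K D) (compField K D D')).fieldRange ≤
      (IsScalarTower.toAlgHom K (sqrtNegField K D) (compField K D D')).fieldRange ⊔
        (IsScalarTower.toAlgHom K (sqrtNegField K D') (compField K D D')).fieldRange :=
    le_sup_left
  have h₂ : (IsScalarTower.toAlgHom K (sqrtNegField K D') (compField K D D')).fieldRange ≤
      (IsScalarTower.toAlgHom K (sqrtNegField K D) (compField K D D')).fieldRange ⊔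
        (IsScalarTower.toAlgHom K (sqrtNegField K D') (compField K D D')).fieldRange :=
    le_sup_right
  exact add_mem (h₁ ⟨x.re, rfl⟩) (mul_mem (h₁ ⟨x.im, rfl⟩) (h₂ ⟨_, rfl⟩))

/-- `[K(√-D)(√-D') : K(√-D')] = 2`, by the tower law (`[· : K] = 4 = 2 · 2`). [folklore] -/
theorem finrank_comp_right : Module.finrank (sqrtNegField K D') (compField K D D') = 2 := by
  have h4 : Module.finrank K (compField K D D') = 4 := by
    rw [← Module.finrank_mul_finrank K (sqrtNegField K D) (compField K D D'),
      finrank_sqrtNegField, finrank_sqrtNegField]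
  have h := Module.finrank_mul_finrank K (sqrtNegField K D') (compField K D D')
  rw [h4, finrank_sqrtNegField] at h
  omega

/-- `K(√-D)(√-D')` is a quadratic, hence Galois, extension of `K(√-D')`. [folklore] -/
theorem isQuadraticExtension_comp_right :
    Algebra.IsQuadraticExtension (sqrtNegField K D') (compField K D D') :=
  ⟨finrank_comp_right⟩

attribute [local instance] isQuadraticExtension_comp_right

variable [CharZero K]

/-- `K(√-D)(√-D')/K(√-D')` is Galois. [folklore] -/
theorem isGalois_comp_right : IsGalois (sqrtNegField K D') (compField K D D') := inferInstance

end Generic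

/-! #### Degenerate case: `-D'` a square in `K(√-D)` -/

section Degenerate

variable {x : sqrtNegField K D}

/-- When `-D' = x²` in `K(√-D)`: the `K`-embedding `K(√-D') → K(√-D)`, `ω' ↦ x`, is bijective
(injective between `K`-spaces of the same dimension `2`). [folklore] -/
theorem liftOfSq_bijective (hx : x ^ 2 = algebraMap K (sqrtNegField K D) (-(D' : K))) :
    Function.Bijective (liftOfSq x hx) := by
  have hinj : Function.Injective (liftOfSq x hx) := (liftOfSq x hx).injective
  refine ⟨hinj, ?_⟩
  have h := (liftOfSq x hx).toLinearMap.injective_iff_surjective_of_finrank_eq_finrank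
    (by rw [finrank_sqrtNegField, finrank_sqrtNegField])
  exact h.mp hinj

/-- The `K(√-D')`-algebra structure on `K(√-D)` through `ω' ↦ x` (used as a local instance).
[folklore] -/
abbrev algebraSelfOfSq (hx : x ^ 2 = algebraMap K (sqrtNegField K D) (-(D' : K))) :
    Algebra (sqrtNegField K D') (sqrtNegField K D) :=
  (liftOfSq x hx).toRingHom.toAlgebra

variable [CharZero K]

/-- With the algebra structure `algebraSelfOfSq hx`: `K ⊆ K(√-D') ⊆ K(√-D)` is a tower, the
extension `K(√-D)/K(√-D')` is Galois (an isomorphism), and `K(√-D)` is generated by the two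
subfields.  Packaged as one statement to keep the local instance inside. [folklore] -/
theorem tower_selfOfSq (hx : x ^ 2 = algebraMap K (sqrtNegField K D) (-(D' : K))) :
    letI := algebraSelfOfSq hx
    IsScalarTower K (sqrtNegField K D') (sqrtNegField K D) ∧
      IsGalois (sqrtNegField K D') (sqrtNegField K D) ∧
      (IsScalarTower.toAlgHom K (sqrtNegField K D) (sqrtNegField K D)).fieldRange ⊔
        (IsScalarTower.toAlgHom K (sqrtNegField K D') (sqrtNegField K D)).fieldRange = ⊤ := by
  letI := algebraSelfOfSq hx
  haveI hT : IsScalarTower K (sqrtNegField K D') (sqrtNegField K D) :=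
    IsScalarTower.of_algebraMap_eq fun y ↦ ((liftOfSq x hx).commutes y).symm
  refine ⟨hT, ?_, ?_⟩
  · -- `K(√-D') ≃ K(√-D)` as `K(√-D')`-algebras
    have hbij := liftOfSq_bijective hx
    let e : sqrtNegField K D' ≃ₐ[sqrtNegField K D'] sqrtNegField K D :=
      AlgEquiv.ofBijective (Algebra.ofId (sqrtNegField K D') (sqrtNegField K D)) hbij
    haveI : Algebra.IsAlgebraic (sqrtNegField K D') (sqrtNegField K D) :=
      Algebra.IsAlgebraic.tower_top (K := K) (sqrtNegField K D')
    haveI : Normal (sqrtNegField K D') (sqrtNegField K D) := Normal.of_algEquiv e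
    exact isGalois_iff.mpr ⟨inferInstance, inferInstance⟩
  · rw [eq_top_iff]
    intro y _
    have h₁ : (IsScalarTower.toAlgHom K (sqrtNegField K D) (sqrtNegField K D)).fieldRange ≤
        (IsScalarTower.toAlgHom K (sqrtNegField K D) (sqrtNegField K D)).fieldRange ⊔
          (IsScalarTower.toAlgHom K (sqrtNegField K D') (sqrtNegField K D)).fieldRange :=
      le_sup_left
    exact h₁ ⟨y, rfl⟩

end Degenerate

end Fields

/-! ### Complete splitting gives `e = f = 1` -/

/-- If `v` has `[M : K]` places of the Galois extension `M` above it, then `e(v) = f(v) = 1`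
(fundamental identity `g · e · f = [M : K]`, Mathlib
`Ideal.ncard_primesOver_mul_ramificationIdxIn_mul_inertiaDegIn`). [folklore] -/
theorem ramificationIdxIn_eq_one_of_ncard_eq_finrank {K M : Type*} [Field K] [NumberField K]
    [Field M] [NumberField M] [Algebra K M] [IsGalois K M] (v : HeightOneSpectrum (𝓞 K))
    (h : (v.asIdeal.primesOver (𝓞 M)).ncard = Module.finrank K M) :
    v.asIdeal.ramificationIdxIn (𝓞 M) = 1 ∧ v.asIdeal.inertiaDegIn (𝓞 M) = 1 := by
  have hid := Ideal.ncard_primesOver_mul_ramificationIdxIn_mul_inertiaDegIn v.asIdeal (𝓞 M)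
    (M ≃ₐ[K] M)
  rw [IsGalois.card_aut_eq_finrank, ← h] at hid
  have hne : (v.asIdeal.primesOver (𝓞 M)).ncard ≠ 0 := by
    rw [h]
    exact Module.finrank_pos.ne'
  have hef : v.asIdeal.ramificationIdxIn (𝓞 M) * v.asIdeal.inertiaDegIn (𝓞 M) = 1 :=
    Nat.eq_of_mul_eq_mul_left (Nat.pos_of_ne_zero hne) (hid.trans (mul_one _).symm)
  exact ⟨Nat.eq_one_of_mul_eq_one_right hef, Nat.eq_one_of_mul_eq_one_left hef⟩

/-! ### Patching over the family `K(√-D)` -/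

end PatchingFamily

end Literature.NumberTheory.Automorphic

namespace Literature.NumberTheory.GaloisRepresentations.QuadraticFamily.GoodPrime

open Literature.NumberTheory.Automorphic Literature.NumberTheory.Automorphic.PatchingFamily

variable {K : Type} [Field K] [NumberField K] {m : ℕ} {B : Set ℕ}
  {k : Type*} [Field k] [TopologicalSpace k] [IsTopologicalRing k] [T2Space k] [CharZero k]
  {n : ℕ}

/-- **Hypothesis (b) of the patching lemma for any two members of the family**, for
representations compatible almost everywhere with one datum on `K`: through the biquadratic
field `K(√-D_i)(√-D_j)` when `-D_j` is not a square in `K(√-D_i)` (`compField`), and through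
`K(√-D_i) ⊇ K(√-D_j)` otherwise (`tower_selfOfSq`; this covers `i = j`), by
`CompatibleAE.exists_conj`.  Deliberate dot-notation extension of `QuadraticFamily.GoodPrime`.
[cite: Sorensen2020, §1 (b)] [cite: HarrisTaylorAMS2001, proof of Thm. VII.1.9 (p. 230)] -/
theorem exists_conj {E : HeightOneSpectrum (𝓞 K) → Multiset k} (i j : GoodPrime K m B)
    {ρᵢ : FramedGaloisRep (sqrtNegField K i.1) k n} {ρⱼ : FramedGaloisRep (sqrtNegField K j.1) k n}
    (hssᵢ : ρᵢ.toGaloisRep.IsSemisimple) (hssⱼ : ρⱼ.toGaloisRep.IsSemisimple)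
    (hᵢ : CompatibleAE E ρᵢ) (hⱼ : CompatibleAE E ρⱼ) :
    ∃ P : GL (Fin n) k, ∀ (x : absoluteGaloisGroup (sqrtNegField K i.1))
      (y : absoluteGaloisGroup (sqrtNegField K j.1)),
      absGaloisRestrict K (sqrtNegField K i.1) x = absGaloisRestrict K (sqrtNegField K j.1) y →
        ρⱼ y = P * ρᵢ x * P⁻¹ := by
  by_cases hsq : IsSquare (-(j.1 : sqrtNegField K i.1))
  · -- degenerate case: `-D_j = x²` in `K(√-D_i)`; take `L = K(√-D_i)`
    obtain ⟨x, hx⟩ := hsq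
    have hx' : x ^ 2 = algebraMap K (sqrtNegField K i.1) (-(j.1 : K)) := by
      rw [map_neg, map_natCast, sq, ← hx]
    letI := algebraSelfOfSq hx'
    obtain ⟨hT, hG, hcomp⟩ := tower_selfOfSq hx'
    haveI := hT
    haveI := hG
    exact CompatibleAE.exists_conj (L := sqrtNegField K i.1) hcomp hssᵢ hssⱼ hᵢ hⱼ
  · -- generic case: the biquadratic field
    haveI : Fact (¬ IsSquare (-(j.1 : sqrtNegField K i.1))) := ⟨hsq⟩
    letI := algebraComp K i.1 j.1
    haveI := isScalarTower_comp (K := K) (D := i.1) (D' := j.1)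
    haveI := isGalois_comp_right (K := K) (D := i.1) (D' := j.1)
    exact CompatibleAE.exists_conj (L := compField K i.1 j.1) fieldRange_sup_fieldRange_comp
      hssᵢ hssⱼ hᵢ hⱼ

/-- **The Galois side of Harris–Lan–Taylor–Thorne's Cor. 7.14 (Harris–Taylor's patching
argument, proof of Thm. VII.1.9), proved.**  Let `K` be a number field, `(K(√-D))_{D ∈ GoodPrime K m X}`
the `∅`-general family of `SGeneralQuadraticFamily` (`m ≠ 0`, `X` finite), `E` a datum of
Frobenius eigenvalues on `K` and `ρ_D : Γ_{K(√-D)} → GL_n(k)` continuous with semisimple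
underlying representations (`k` a Hausdorff topological field of characteristic `0`), each
compatible almost everywhere with `E` (`CompatibleAE`).  Let `T` be a set of finite places of `K`
such that every `v ∈ T` splits completely in some member `K(√-D)` with `ρ_D` unramified of
characteristic polynomial `∏_{a ∈ E v}(X - a)` at every place above `v`.  Then there is a
continuous `r : Γ_K → GL_n(k)` with semisimple underlying representation such that
`r|_{Γ_{K(√-D)}} ≃ ρ_D` for every member and, for every `v ∈ T`, `r` is unramified at `v` with
characteristic polynomial of Frobenius `∏_{a ∈ E v}(X - a)`.  Proof: Sorensen's (a), (b) hold
(`CompatibleAE.nonempty_equiv_outerConj`, `GoodPrime.exists_conj`), so the patching lemma over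
the family (`GoodPrime.exists_framedGaloisRep`) gives `r`; at `v ∈ T` the properties of `ρ_D`
transfer to `r|_{Γ_{K(√-D)}}` (`isUnramifiedAt_of_equiv`, `hasFrobCharpolyAt_of_equiv`) and
descend to `r` because `v` splits completely (`e = f = 1`,
`FramedGaloisRep.isUnramifiedAt_of_restrictField`, `hasFrobCharpolyAt_of_restrictField`) —
"`y` splits as `y'y''` in `LA` … `[R_l(Π)|_{W_{F_y}}] = [R_l(Res Π)|_{W_{F_{y'}}}] = [r_l(ı⁻¹Π_y)]`".
`r` is unique up to isomorphism (`GoodPrime.nonempty_equiv_of_forall_restrictField`).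
[cite: HarrisLanTaylorThorneRMS2016, proof of Cor. 7.14 (p. 232)]
[cite: HarrisTaylorAMS2001, proof of Thm. VII.1.9 (pp. 229–232)] -/
theorem exists_framedGaloisRep_of_compatibleAE (hm : m ≠ 0) (hB : B.Finite)
    (E : HeightOneSpectrum (𝓞 K) → Multiset k)
    (ρ : ∀ i : GoodPrime K m B, FramedGaloisRep (sqrtNegField K i.1) k n)
    (hss : ∀ i, (ρ i).toGaloisRep.IsSemisimple) (hE : ∀ i, CompatibleAE E (ρ i))
    (T : Set (HeightOneSpectrum (𝓞 K)))
    (hT : ∀ v ∈ T, ∃ i : GoodPrime K m B,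
      (v.asIdeal.primesOver (𝓞 (sqrtNegField K i.1))).ncard = 2 ∧
        ∀ w : HeightOneSpectrum (𝓞 (sqrtNegField K i.1)), w.asIdeal.under (𝓞 K) = v.asIdeal →
          (ρ i).IsUnramifiedAt w ∧
            (ρ i).HasFrobCharpolyAt w (((E v).map fun a ↦ Polynomial.X - C a).prod)) :
    ∃ r : FramedGaloisRep K k n, r.toGaloisRep.IsSemisimple ∧
      (∀ i, Nonempty (ContinuousRep.Equiv
        (r.restrictField (sqrtNegField K i.1)).toGaloisRep (ρ i).toGaloisRep)) ∧
      ∀ v ∈ T, r.IsUnramifiedAt v ∧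
        r.HasFrobCharpolyAt v (((E v).map fun a ↦ Polynomial.X - C a).prod) := by
  obtain ⟨r, hrss, hr⟩ := exists_framedGaloisRep hm hB ρ hss
    (fun i τ ↦ (hE i).nonempty_equiv_outerConj (hss i) τ)
    (fun i j ↦ exists_conj i j (hss i) (hss j) (hE i) (hE j))
  refine ⟨r, hrss, hr, fun v hv ↦ ?_⟩
  obtain ⟨i, hsplit, hw⟩ := hT v hv
  have hsplit' : (v.asIdeal.primesOver (𝓞 (sqrtNegField K i.1))).ncard =
      Module.finrank K (sqrtNegField K i.1) := by rw [finrank_sqrtNegField]; exact hsplit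
  obtain ⟨he, hf⟩ := ramificationIdxIn_eq_one_of_ncard_eq_finrank v hsplit'
  set e := (Classical.choice (hr i)).symm
  have hunr : r.IsUnramifiedAt v :=
    r.isUnramifiedAt_of_restrictField (M := sqrtNegField K i.1) he fun w hwv ↦
      FramedGaloisRep.isUnramifiedAt_of_equiv e (hw w hwv).1
  exact ⟨hunr, r.hasFrobCharpolyAt_of_restrictField hunr hf fun w hwv ↦
    FramedGaloisRep.hasFrobCharpolyAt_of_equiv e (hw w hwv).2⟩

end Literature.NumberTheory.GaloisRepresentations.QuadraticFamily.GoodPrime
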